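/-
Copyright (c) 2026 the pub-hodgecm-mathlib formalisation cell (harness21).  Prover seat hodgecm-mathlib-K2E3-p06 (g7), Track B «K2-LIT»,
#184♮ = hLiu418 = `stmt-HodgeConjecture-24832`; socket #41, KIND W, (iii-fin) row (KW-fin-stab) — LEAD F0P6-plan (g15) BATCH #215 (1), KW desk F0P2-p08 (g4) (R) POLE:
THE CLOSED HEAD — the QUANTITATIVE radius-stability letter `hstab` of ★ p863720 `K2LiuKindWFiniteSizeLetterOfPlace.hsizeLoc_of_place` with EVERY place constant discharged.
THEOREMS ONLY (no `def`, no `instance`, no notation, no named-fact hypothesis, no `sorry`); lane `--supports stmt-HodgeConjecture-24832` (count-neutral helper).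
-/
import Summits.HodgeConjecture.HodgeConjecture.Theorems.K2LiuKindWFiniteRadiusStabilityOfLetters  -- (R) FILE 3 (K2E3-p29 (g3)): `hstab_of_letters`
import Summits.HodgeConjecture.HodgeConjecture.Theorems.K2LiuKindWFiniteRadiusPlaceFunctions     -- (R) place functions (F0P2-p09 (g3)): `exists_radius_place_functions`
import Summits.HodgeConjecture.HodgeConjecture.Theorems.K2LiuHeckeLocalConductorLetters          -- ★ p864309 (K2E3-p37 (g3)): `exists_conductor_letters_placesOver`
import Summits.HodgeConjecture.HodgeConjecture.Theorems.K2LiuBadPlaceWhittakerBallRadii          -- ★ p864297 + ED. 2 (F0P2-p09 (g3)): `whittaker_setIntegral_ball_stable_of_radii`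
import Summits.HodgeConjecture.HodgeConjecture.Theorems.K2LiuLocalLeviSupplyExplicit             -- ★ p864290 (K2E3-p37 (g3)): `hsup_of_radius`, `hinv_of_radius`
import HarnessLib

/-!
# Crux `HLiu418`, socket #41, KIND W, (KW-fin-stab) CLOSED HEAD — `K2LiuKindWFiniteRadiusStability`: THE QUANTITATIVE RADIUS-STABILITY LETTER `hstab` OF ★ p863720 WITH EVERY
# PLACE CONSTANT DISCHARGED — `hstab_of_level_conductor`

Cell `hodgecm-mathlib`, crux item hLiu418 = `stmt-HodgeConjecture-24832` (helper lane `--supports … --as helper`, count-neutral), route of record `HCCMUnconditional`;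
squad K2 ∕ K2Liu, road `K2_Liu`, socket #41 `sig_K2LiuSiegelEisensteinContinuation`, KIND W, (iii-fin) row.  THE (R) POLE (LEAD F0P6-plan (g15) BATCH #215 (1); architect K2E3-p06
(g7); KW desk F0P2-p08 (g4) re-cuts 2026-09-05T01:23:54Z ∕ 01:33:51Z ∕ 01:49:49Z): ★ p863720 `K2LiuKindWFiniteSizeLetterOfPlace.hsizeLoc_of_place` takes BY VALUE the QUANTITATIVE
radius-stability letter `(Tρ ρ hρ a₁ a₂ a₃ hstab)` — at every place `v ∈ U(S,h)` of the presentation the Φ5-ball integrals of the local Whittaker integrand are constant beyond a radius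
`R ≤ Σ_{w∣v}(ρ w + a₁·lev h w + a₂·dS w + a₃·dA w)` with `ρ` of FINITE support.  That letter is Karel's lemma with a radius AFFINE IN THE LEVEL and with every other constant an
explicit finite-support function of the place; the chain that pays it:
★ p864100 FILE 1 `K2LiuLocalLeviSupplyLevel` (the level of the Siegel–Levi moves) → ★ p864134 ∕ ★ p864173 FILE 2 ∕ 2′ `K2LiuBadPlaceWhittakerFarShells{Level,Radii}` (far shells dead
beyond `max j₀ 0 + max j₁ 0 + |d| + 2|c_ε| + 2|c₂| + 2|b_T| + 2 + Σ_w M_w + 4b + 2b′`) → ★ p864209 ∕ ★ p864297 (+ ED. 2) twins `K2LiuBadPlaceWhittakerBall{Level,Radii}` (F0P2-p09 (g3):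
ball constancy for the right translate, Tate's `ψ`, `τ := Tr`) → ★ p864290 FILE 2b `K2LiuLocalLeviSupplyExplicit` (K2E3-p37 (g3): the supply ∕ integrality letters at the explicit
radii `j₀ = 1 + Σ_w cχ_w`, `j₁ = 2|b_T| + 1`) → ★ p864309 `K2LiuHeckeLocalConductorLetters` (K2E3-p37: `cχ = conductorExponentAt`, cofinitely `0`) → (R) place functions
`K2LiuKindWFiniteRadiusPlaceFunctions` (F0P2-p09: `d, c₂, b_T, c_ε, ε` with their letters, cofinitely `0`) → (R) FILE 3 `K2LiuKindWFiniteRadiusStabilityOfLetters.hstab_of_letters`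
(K2E3-p29 (g3): the (iii-fin) dress, hypothesis-first in `hballM`, `K₀ cb c₂ Kg hTK h2`) → THIS FILE.
THE THEOREM **`hstab_of_level_conductor`**: BY VALUE only the honest (KW-fac) ∕ (ι) letters — the Siegel-section and continuity letters `hf hfc` of the local factors `FvT j S h v`
at non-singular indices (for `χ_v := (χ.localComponent w)_{w∣v}`), the translated LEVEL letter `hMinv` at exponents `M h w` (★ p863964 §4 shape), `hMlev : M ≤ lev`,
`hMK : h_v ∉ K_{H,v} ⇒ ∃ w∣v, 1 ≤ M h w` (★ p864220 `hMK_of_hA`) — and the conclusion is ★ p863720's binder block: `∃ Tρ ρ a₁ a₂ a₃, (∀ w ∉ Tρ, ρ w = 0) ∧ ‹hstab :216–:240 VERBATIM›`.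
PROOF (plumbing): `K₀ v := max (1 + Σ_{w∣v} cχ_w) 0 + max (2|b_T v| + 1) 0 + |d v| + 2|c_ε v| + 2|c₂ v| + 2|b_T v| + 2`, `cb v := (2 b_T v)⁺`, `Kg := 4`, `TK := Bad ∪ TF` (off `TK` every
constant vanishes, so `K₀ v + 4(cb v + c₂ v) = 4`); `hballM v` := the ★ B2 Skew chart at `v` (★ `exists_homeomorph_skew_of_carrier`, Haar ∕ regular ∕ locally compact letters ★ p863793
`skewCarrier_measure_letters`) and ★ `whittaker_setIntegral_ball_stable_of_radii` at the CM frame `(L⁺, L, c, δ := imagUnit, v, n, gramR, hermD)` fed with the place letters, ★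
`hsup_of_radius` (at `hχc` of ★ p864309) and ★ `hinv_of_radius`; then ★ `hstab_of_letters`.
[Casselman1980, §3]; [KudlaRallis1994, §2]; [Shimura1997, §18.3–18.4]; [PlatonovRapinchuk1994, §5.1]; [Weil1965, §37]; [CasselsFrohlichANT1967, Ch. II §10, Ch. XV §2.2].
HONEST LABEL.  Count-neutral helper, closes no socket: `HC_CM` is proved only modulo the 7 printed citations (2 remaining named inputs: hLiu418 = `stmt-HodgeConjecture-24832`,
h413 = `stmt-HodgeConjecture-24833`) until rung 0 closes.  BY VALUE (payers named): `hf hfc` ((KW-fac) reading, ★ p863964's frame), `hMinv` (★ p863964 §4 at `M := c_L + 2A`),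
`hMlev hMK` ((ι) ★ p864124 ∕ ★ p864220).

## References
* [Casselman1980] W. Casselman, *The unramified principal series of p-adic groups I*, Compositio Math. 40 (1980): §3.
* [KudlaRallis1994] S. Kudla, S. Rallis, *A regularized Siegel–Weil formula: the first term identity*, Ann. of Math. 140 (1994): §2.
* [Shimura1997] G. Shimura, *Euler products and Eisenstein series*, CBMS 93 (1997): §18.3–18.4.
* [PlatonovRapinchuk1994] V. Platonov, A. Rapinchuk, *Algebraic Groups and Number Theory* (1994): §5.1.
* [Weil1965] A. Weil, *L'intégration dans les groupes topologiques et ses applications* (2nd ed. 1965): §37.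
* [CasselsFrohlichANT1967] Cassels–Fröhlich (eds.), *Algebraic Number Theory* (1967): Ch. II §10; Ch. XV (Tate) §2.2.
-/

set_option autoImplicit false
-- the mandated namespace repeats the single-problem summit's segment (`HodgeConjecture.HodgeConjecture`)
set_option linter.dupNamespace false

noncomputable section

open scoped Matrix RestrictedProduct ENNReal NNReal Topology ComplexConjugate BigOperators
open NumberField IsDedekindDomain MeasureTheory Measure Filter Set Metric ValuativeRel

namespace Summit.HodgeConjecture.HodgeConjecture.Cruxes.HLiu418.K2LiuKindWFiniteRadiusStability

open Literature.NumberTheory.Automorphic hiding IsKFinite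
open Literature.NumberTheory.Automorphic.UnitaryGroup Literature.NumberTheory.GaloisRepresentations Literature.NumberTheory.LFunctions
open Literature.NumberTheory.GelbartRogawski1991 Literature.NumberTheory.GelbartRogawski1991.GRConstruction
open Literature.NumberTheory.GelbartRogawski1991.AdaptedBlocks
open Literature.NumberTheory.GelbartRogawski1991.UnitaryDualPair
open Literature.NumberTheory.K2Lit Literature.NumberTheory.K2Lit.SiegelDoubled Literature.NumberTheory.K2Lit.LocalSiegelDoubled Literature.NumberTheory.K2Lit.PlaceSplitting
open Summit.HodgeConjecture.HodgeConjecture.Cruxes.HLiu418.K2LiuSiegelUnipotentLocalDefs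
open Summit.HodgeConjecture.HodgeConjecture.Cruxes.HLiu418.K2LiuSiegelUnipotentFourierDefs
open Summit.HodgeConjecture.HodgeConjecture.Cruxes.HLiu418.K2LiuSiegelEisensteinKindWLetters
open Summit.HodgeConjecture.HodgeConjecture.Cruxes.HLiu418.K2LiuKindWFiniteLetterDefs (kindWLocalBall)
open Summit.HodgeConjecture.HodgeConjecture.Cruxes.HLiu418.K2LiuKindWFiniteLetterHolomorphic (skewCarrier_measure_letters)
open Summit.HodgeConjecture.HodgeConjecture.Cruxes.HLiu418.K2LiuUnipDeltaLocBridge (mem_unipDeltaLoc_iff_mem_unipDeltaLocal)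
open Summit.HodgeConjecture.HodgeConjecture.Cruxes.HLiu418.K2LiuUnipDeltaLocalHaarTransport (exists_homeomorph_skew_of_carrier)
open Summit.HodgeConjecture.HodgeConjecture.Cruxes.HLiu418.K2LiuBadPlaceWhittakerBallRadii (whittaker_setIntegral_ball_stable_of_radii)
open Summit.HodgeConjecture.HodgeConjecture.Cruxes.HLiu418.K2LiuLocalLeviSupplyExplicit (hsup_of_radius hinv_of_radius)
open Summit.HodgeConjecture.HodgeConjecture.Cruxes.HLiu418.K2LiuHeckeLocalConductorLetters (exists_conductor_letters_placesOver)
open Summit.HodgeConjecture.HodgeConjecture.Cruxes.HLiu418.K2LiuKindWFiniteRadiusPlaceFunctions (exists_radius_place_functions)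
open Summit.HodgeConjecture.HodgeConjecture.Cruxes.HLiu418.K2LiuKindWFiniteRadiusStabilityOfLetters (hstab_of_letters)

variable (L : Type) [Field L] [NumberField L] [IsCMField L]
variable {N M n : ℕ} (e : Fin N × Fin M ≃ Fin n)
  (dV : Fin N → L) (hdV : ∀ i, IsCMField.complexConj L (dV i) = dV i)
  (dW : Fin M → L) (hdW : ∀ i, IsCMField.complexConj L (dW i) = dW i)

variable [∀ v : HeightOneSpectrum (𝓞 (Fp L)), MeasurableSpace ↥(unipDeltaLoc L e dV hdV dW hdW v)]
  [∀ v : HeightOneSpectrum (𝓞 (Fp L)), BorelSpace ↥(unipDeltaLoc L e dV hdV dW hdW v)]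

/-! ## The radius bookkeeping off the bad set -/

omit [NumberField L] [IsCMField L] in
/-- off the bad set every place constant vanishes, so the Karel constant is `4` and the index thresholds are `0`. [folklore] -/
theorem radius_const_eq_four {ι : Type*} [Fintype ι] {cχ : ι → ℕ} {d c₂ bT cε : ℤ} (hcχ : ∀ w, cχ w = 0) (hd : d = 0) (hc₂ : c₂ = 0) (hbT : bT = 0) (hcε : cε = 0) :
    max (1 + ∑ w, (cχ w : ℤ)) 0 + max (2 * |bT| + 1) 0 + |d| + 2 * |cε| + 2 * |c₂| + 2 * |bT| + 2 + 4 * (((2 * bT).toNat : ℤ) + ((c₂.toNat : ℕ) : ℤ)) ≤ 4 := by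
  subst hd hc₂ hbT hcε
  simp [hcχ]

/-! ## The closed head -/

set_option maxHeartbeats 1600000 in -- MEASURED: 800 000 ✗ (deterministic timeout at `isDefEq` of the ★ `whittaker_setIntegral_ball_stable_of_radii` term), 1 600 000 ✓ — the statement repeats ★ p863720's two dependent `FvT` letter blocks and the CM-frame telescope (the class of ★ p863793 §2 ∕ ★ p864399); plain `obtain`∕`refine`∕`exact`, no search tactics
/-- **THE QUANTITATIVE RADIUS-STABILITY LETTER OF ★ p863720, CLOSED** (`(Tρ ρ hρ a₁ a₂ a₃ hstab)` inhabited with EVERY place constant discharged).  K2Lit CM datum with `dV`,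
`dW` non-zero; bad set `T₀`; Haar carriers `νv`; uniformisers `π v` of `L⁺` (`hπ`) and `ϖ w` of `L` (`hϖ`); the local factors `FvT` of the `T(S,h)`-part; a Hecke character `χ`
of `L` (at the tie: `toHeckeCharacter L lam⁻¹`).  BY VALUE (honest (KW-fac) ∕ (ι) letters, payers in the module docstring): the Siegel-section and continuity letters `hf hfc` of the
factors at non-singular indices for `χ_v := (χ.localComponent w)_{w∣v}`, the translated LEVEL letter `hMinv` at exponents `M h w`, `hMlev : M ≤ lev`, `hMK`.  THEN
`∃ Tρ ρ a₁ a₂ a₃, (∀ w ∉ Tρ, ρ w = 0) ∧ ‹★ p863720's hstab binder :216–:240 VERBATIM›`.  PROOF: (R) FILE 3 `hstab_of_letters` with `K₀ v := max (1 + Σ_{w∣v} cχ w) 0 +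
max (2|b_T v| + 1) 0 + |d v| + 2|c_ε v| + 2|c₂ v| + 2|b_T v| + 2`, `cb v := (2 b_T v)⁺`, `c₂ v := (c₂ v)⁺`, `Kg := 4`, `TK := Bad ∪ TF` from the place functions
(`exists_radius_place_functions`) and the χ-conductor letters (★ `exists_conductor_letters_placesOver`); `hballM v` := the ★ B2 Skew chart + ★ `skewCarrier_measure_letters` + ★
`whittaker_setIntegral_ball_stable_of_radii` at the CM frame fed by ★ `hsup_of_radius` ∕ ★ `hinv_of_radius` (K2E3-p37's kernel cert 2026-09-05T01:57Z, PART B).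
[cite: Casselman1980, §3] [cite: KudlaRallis1994, §2] [cite: Shimura1997, §18.3–18.4] [cite: PlatonovRapinchuk1994, §5.1] [cite: Weil1965, §37] -/
theorem hstab_of_level_conductor (hdV0 : ∀ i, dV i ≠ 0) (hdW0 : ∀ i, dW i ≠ 0)
    (T₀ : Finset (HeightOneSpectrum (𝓞 (Fp L))))
    (νv : ∀ v : HeightOneSpectrum (𝓞 (Fp L)), Measure ↥(unipDeltaLoc L e dV hdV dW hdW v)) [hν : ∀ v, (νv v).IsHaarMeasure]
    {π : ∀ v : HeightOneSpectrum (𝓞 (Fp L)), v.adicCompletion (Fp L)} (hπ : ∀ v, Valued.v (π v) = WithZero.exp (-1 : ℤ)) {m : ℕ}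
    (FvT : Fin m → ∀ (S : skewMatrices ((IsCMField.complexConj L : L ≃ₐ[Fp L] L) : L →+* L) ((gramR L e dV hdV dW hdW).map (algebraMap (Fp L) L)))
      (h : HA L e dV hdV dW hdW) (v : (kindWFinset L e dV hdV dW hdW T₀ (S : Matrix (Fin n) (Fin n) L) h)),
      ℂ → UnitaryGroup.localPi L (IsCMField.complexConj L) (n + n) (hermD L e dV hdV dW hdW) v.1 → ℂ)
    -- the Hecke character and the Siegel-section letters of the factors at non-singular indices (★ p863793 §3 shapes)
    (χ : HeckeCharacter L)
    (hf : ∀ (j : Fin m) (S : skewMatrices ((IsCMField.complexConj L : L ≃ₐ[Fp L] L) : L →+* L) ((gramR L e dV hdV dW hdW).map (algebraMap (Fp L) L)))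
      (h : HA L e dV hdV dW hdW) (v : (kindWFinset L e dV hdV dW hdW T₀ (S : Matrix (Fin n) (Fin n) L) h)) (s : ℂ), (S : Matrix (Fin n) (Fin n) L).det ≠ 0 →
      IsLocalSiegelSection (Fp L) L (IsCMField.complexConj L) (complexConj_imagUnit L) (imagUnit_ne_zero L) (imagUnit_mul_self L) v.1 n
        (gramR_isSymm L e dV hdV dW hdW) (hermD_eq_map_gramD L e dV hdV dW hdW) (fun w => χ.localComponent w.1) s (FvT j S h v s))
    (hfc : ∀ (j : Fin m) (S : skewMatrices ((IsCMField.complexConj L : L ≃ₐ[Fp L] L) : L →+* L) ((gramR L e dV hdV dW hdW).map (algebraMap (Fp L) L)))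
      (h : HA L e dV hdV dW hdW) (v : (kindWFinset L e dV hdV dW hdW T₀ (S : Matrix (Fin n) (Fin n) L) h)) (s : ℂ), (S : Matrix (Fin n) (Fin n) L).det ≠ 0 →
      Continuous (FvT j S h v s))
    -- the LEVEL letter of the translated factors (★ p863964 §4 shape) and its comparison with the shared level data
    (ϖ : (w : HeightOneSpectrum (𝓞 L)) → w.adicCompletion L) (hϖ : ∀ w, Valued.v (ϖ w) = WithZero.exp (-1 : ℤ)) (M : HA L e dV hdV dW hdW → HeightOneSpectrum (𝓞 L) → ℕ)
    (hMinv : ∀ (j : Fin m) (S : skewMatrices ((IsCMField.complexConj L : L ≃ₐ[Fp L] L) : L →+* L) ((gramR L e dV hdV dW hdW).map (algebraMap (Fp L) L)))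
      (h : HA L e dV hdV dW hdW) (v : (kindWFinset L e dV hdV dW hdW T₀ (S : Matrix (Fin n) (Fin n) L) h)) (s : ℂ)
      (y k : UnitaryGroup.localPi L (IsCMField.complexConj L) (n + n) (hermD L e dV hdV dW hdW) v.1),
      (∀ w : UnitaryGroup.PlacesOver L v.1,
        (k : UnitaryGroup.LocalGLPi L (n + n) v.1) w ∈ congruenceGL (n + n) (valuation (w.1.adicCompletion L) (ϖ w.1) ^ M h w.1)) →
      FvT j S h v s (y * k * UnitaryGroup.evalPlace (Fp L) L (IsCMField.complexConj L) (n + n) (hermD L e dV hdV dW hdW) v.1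
          (UnitaryGroup.finPart (Fp L) L (IsCMField.complexConj L) (n + n) (hermD L e dV hdV dW hdW) h)) =
        FvT j S h v s (y * UnitaryGroup.evalPlace (Fp L) L (IsCMField.complexConj L) (n + n) (hermD L e dV hdV dW hdW) v.1
          (UnitaryGroup.finPart (Fp L) L (IsCMField.complexConj L) (n + n) (hermD L e dV hdV dW hdW) h)))
    (lev : HA L e dV hdV dW hdW → HeightOneSpectrum (𝓞 L) → ℕ) (hMlev : ∀ (h : HA L e dV hdV dW hdW) (w : HeightOneSpectrum (𝓞 L)), M h w ≤ lev h w)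
    (hMK : ∀ (h : HA L e dV hdV dW hdW) (v : HeightOneSpectrum (𝓞 (Fp L))),
      UnitaryGroup.evalPlace (Fp L) L (IsCMField.complexConj L) (n + n) (hermD L e dV hdV dW hdW) v
          (UnitaryGroup.finPart (Fp L) L (IsCMField.complexConj L) (n + n) (hermD L e dV hdV dW hdW) h) ∉
        UnitaryGroup.localInt L (IsCMField.complexConj L) (n + n) (hermD L e dV hdV dW hdW) v →
      ∃ w : UnitaryGroup.PlacesOver L v, 1 ≤ M h w.1) :
    ∃ (Tρ : Finset (HeightOneSpectrum (𝓞 L))) (ρ : HeightOneSpectrum (𝓞 L) → ℕ) (a₁ a₂ a₃ : ℕ), (∀ w ∉ Tρ, ρ w = 0) ∧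
      ∀ (j : Fin m) (S : skewMatrices ((IsCMField.complexConj L : L ≃ₐ[Fp L] L) : L →+* L) ((gramR L e dV hdV dW hdW).map (algebraMap (Fp L) L)))
        (h : HA L e dV hdV dW hdW) (v : (kindWFinset L e dV hdV dW hdW T₀ (S : Matrix (Fin n) (Fin n) L) h)), (S : Matrix (Fin n) (Fin n) L).det ≠ 0 →
        ∀ (s : ℂ) (dS dA : HeightOneSpectrum (𝓞 L) → ℕ),
        (∀ (w : UnitaryGroup.PlacesOver L v.1) (a b : Fin n), Valued.v ((((S : Matrix (Fin n) (Fin n) L) a b : L)) : w.1.adicCompletion L) ≤ WithZero.exp ((dS w.1 : ℕ) : ℤ)) →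
        (∀ (w : UnitaryGroup.PlacesOver L v.1) (a b : Fin n), Valued.v ((((S : Matrix (Fin n) (Fin n) L)⁻¹ a b : L)) : w.1.adicCompletion L) ≤ WithZero.exp ((dA w.1 : ℕ) : ℤ)) →
        ∃ R : ℕ, R ≤ ∑ w : UnitaryGroup.PlacesOver L v.1, (ρ w.1 + a₁ * lev h w.1 + a₂ * dS w.1 + a₃ * dA w.1) ∧
          ∀ k' : ℕ, R ≤ k' →
            ∫ y in kindWLocalBall L e dV hdV dW hdW v.1 (π v.1) (-(k' : ℤ)),
              conj (unipDeltaChar L e dV hdV dW hdW (S : Matrix (Fin n) (Fin n) L)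
                  (locToAdelic L e dV hdV dW hdW v.1
                    ((y : ↥(unipDeltaLoc L e dV hdV dW hdW v.1)) : UnitaryGroup.localPi L (IsCMField.complexConj L) (n + n) (hermD L e dV hdV dW hdW) v.1)) : ℂ) *
                FvT j S h v s (UnitaryGroup.evalPlace (Fp L) L (IsCMField.complexConj L) (n + n) (hermD L e dV hdV dW hdW) v.1
                      (UnitaryGroup.finPart (Fp L) L (IsCMField.complexConj L) (n + n) (hermD L e dV hdV dW hdW) (weylDelta L e dV hdV dW hdW)) *
                    ((y : ↥(unipDeltaLoc L e dV hdV dW hdW v.1)) : UnitaryGroup.localPi L (IsCMField.complexConj L) (n + n) (hermD L e dV hdV dW hdW) v.1) *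
                    UnitaryGroup.evalPlace (Fp L) L (IsCMField.complexConj L) (n + n) (hermD L e dV hdV dW hdW) v.1
                      (UnitaryGroup.finPart (Fp L) L (IsCMField.complexConj L) (n + n) (hermD L e dV hdV dW hdW) h)) ∂(νv v.1) =
            ∫ y in kindWLocalBall L e dV hdV dW hdW v.1 (π v.1) (-(R : ℤ)),
              conj (unipDeltaChar L e dV hdV dW hdW (S : Matrix (Fin n) (Fin n) L)
                  (locToAdelic L e dV hdV dW hdW v.1
                    ((y : ↥(unipDeltaLoc L e dV hdV dW hdW v.1)) : UnitaryGroup.localPi L (IsCMField.complexConj L) (n + n) (hermD L e dV hdV dW hdW) v.1)) : ℂ) *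
                FvT j S h v s (UnitaryGroup.evalPlace (Fp L) L (IsCMField.complexConj L) (n + n) (hermD L e dV hdV dW hdW) v.1
                      (UnitaryGroup.finPart (Fp L) L (IsCMField.complexConj L) (n + n) (hermD L e dV hdV dW hdW) (weylDelta L e dV hdV dW hdW)) *
                    ((y : ↥(unipDeltaLoc L e dV hdV dW hdW v.1)) : UnitaryGroup.localPi L (IsCMField.complexConj L) (n + n) (hermD L e dV hdV dW hdW) v.1) *
                    UnitaryGroup.evalPlace (Fp L) L (IsCMField.complexConj L) (n + n) (hermD L e dV hdV dW hdW) v.1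
                      (UnitaryGroup.finPart (Fp L) L (IsCMField.complexConj L) (n + n) (hermD L e dV hdV dW hdW) h)) ∂(νv v.1) := by
  classical
  haveI : Algebra.IsQuadraticExtension (Fp L) L := IsCMField.isQuadraticExtension L
  -- the Borel structures on the Skew carriers (the instance binders of (R) FILE 3)
  letI : ∀ v : HeightOneSpectrum (𝓞 (Fp L)),
      MeasurableSpace ↥(skewMatrices (conjLocal L (IsCMField.complexConj L) v) (LocalSplitting.gramS (Fp L) L v n (gramR L e dV hdV dW hdW))) := fun v => borel _
  haveI : ∀ v : HeightOneSpectrum (𝓞 (Fp L)),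
      BorelSpace ↥(skewMatrices (conjLocal L (IsCMField.complexConj L) v) (LocalSplitting.gramS (Fp L) L v n (gramR L e dV hdV dW hdW))) := fun v => ⟨rfl⟩
  -- the place functions (F0P2-p09) and the χ-conductor letters (★ p864309)
  obtain ⟨Bad, d, c₂, bT, cε, ε, hzero, hnonneg, hdata⟩ := exists_radius_place_functions L e dV hdV dW hdW hdV0 hdW0 hπ
  obtain ⟨TF, cχ, hTF, hχc⟩ := exists_conductor_letters_placesOver (Fp L) L χ ϖ hϖ
  refine hstab_of_letters L e dV hdV dW hdW T₀ νv hπ FvT (fun v w => χ.localComponent w.1) hf hfc ϖ M hMinv lev hMlev hMK (Bad ∪ TF)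
    (fun v => max (1 + ∑ w : UnitaryGroup.PlacesOver L v, (cχ w.1 : ℤ)) 0 + max (2 * |bT v| + 1) 0 + |d v| + 2 * |cε v| + 2 * |c₂ v| + 2 * |bT v| + 2)
    (fun v => (2 * bT v).toNat) (fun v => (c₂ v).toNat) 4 (fun v hv => ?_) (fun v w => ?_) (fun v => ?_)
  · -- the UNIFORMITY letter: off `Bad ∪ TF` every constant vanishes
    rw [Finset.mem_union, not_or] at hv
    obtain ⟨hd, hc₂, hbT, hcε⟩ := hzero v hv.1
    exact radius_const_eq_four (fun w => hTF v hv.2 w) hd hc₂ hbT hcε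
  · -- the two-adic letter at `(c₂ v)⁺ = c₂ v`
    have h := (hdata v).2.1 w
    rwa [Int.toNat_of_nonneg (hnonneg v).1]
  · -- the KAREL-WITH-LEVEL letter at `v`: the ★ B2 chart, its Haar ∕ regular ∕ locally compact letters, and ★ `whittaker_setIntegral_ball_stable_of_radii`
    obtain ⟨hdψ, h2, hTb, hTib, hεσ, hεint, hε⟩ := hdata v
    have hSk : ∀ t, t ∈ skewMatrices (conjLocal L (IsCMField.complexConj L) v) (LocalSplitting.gramS (Fp L) L v n (gramR L e dV hdV dW hdW)) ↔
        (t.map (conjLocal L (IsCMField.complexConj L) v))ᵀ * LocalSplitting.gramS (Fp L) L v n (gramR L e dV hdV dW hdW) +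
          LocalSplitting.gramS (Fp L) L v n (gramR L e dV hdV dW hdW) * t = 0 :=
      fun t => (mem_skewMatrices_iff _ _ t).trans (by rw [add_comm])
    obtain ⟨ψ, hψ, -⟩ := exists_homeomorph_skew_of_carrier (F := Fp L) (E := L) (c := IsCMField.complexConj L) (v := v) (n := n)
      (hJD := hermD_eq_map_gramD L e dV hdV dW hdW) (N' := unipDeltaLoc L e dV hdV dW hdW v) (hN' := mem_unipDeltaLoc_iff_mem_unipDeltaLocal L e dV hdV dW hdW v)
      (S := skewMatrices (conjLocal L (IsCMField.complexConj L) v) (LocalSplitting.gramS (Fp L) L v n (gramR L e dV hdV dW hdW))) (hS := hSk)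
    obtain ⟨hHaar, hReg, hLC⟩ := skewCarrier_measure_letters L e dV hdV dW hdW v _ hSk ψ hψ (νv v)
    haveI := hHaar; haveI := hReg; haveI := hLC
    refine ⟨ψ, hψ, fun Mv x f hf' hfMx hfc' b b' β βinv hb hb' hcb hβs hββ hβ hβinv s k hk => ?_⟩
    have h2bT : 2 * bT v ≤ b := by
      have h0 : ((2 * bT v).toNat : ℤ) = 2 * bT v := Int.toNat_of_nonneg (by have := (hnonneg v).2.1; omega)
      rw [← h0]; exact hcb
    exact whittaker_setIntegral_ball_stable_of_radii (Fp L) L (IsCMField.complexConj L) (complexConj_imagUnit L) (imagUnit_ne_zero L) (imagUnit_mul_self L) v n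
      (gramR_isSymm L e dV hdV dW hdW) (isUnit_det_gramR₀ L e dV hdV hdV0 dW hdW hdW0) (hermD_eq_map_gramD L e dV hdV dW hdW) (hπ v) _ hSk (Measure.map ψ (νv v))
      hdψ hεσ hεint hε h2 hTb hTib (1 + ∑ w : UnitaryGroup.PlacesOver L v, (cχ w.1 : ℤ))
      (hsup_of_radius (Fp L) L (IsCMField.complexConj L) (complexConj_imagUnit L) (imagUnit_ne_zero L) (imagUnit_mul_self L) v n (gramR_isSymm L e dV hdV dW hdW)
        (isUnit_det_gramR₀ L e dV hdV hdV0 dW hdW hdW0) (hermD_eq_map_gramD L e dV hdV dW hdW) (hπ v) hεint (fun w => χ.localComponent w.1) (fun w => hϖ w.1)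
        (fun w => cχ w.1) (fun w => hχc v w) le_rfl)
      (2 * |bT v| + 1) (hinv_of_radius (Fp L) L (IsCMField.complexConj L) v n (hπ v) hεint hTb hTib le_rfl) (fun w => hϖ w.1) Mv hf' x hfMx hfc' hb hb' h2bT hβs hββ hβ hβinv
      s k hk


end Summit.HodgeConjecture.HodgeConjecture.Cruxes.HLiu418.K2LiuKindWFiniteRadiusStability

end
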